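import Mathlib.Algebra.Polynomial.Basis
import Literature.Barriers.Schanuel.AxSchanuelFunctionalNotNumerical
import HarnessLib

/-!
# Bays–Kirby–Wilkie 2010, Theorem 1.2 — proof (discharge of `baysKirbyWilkie2010_thm_1_2`)

Proofs file for the barrier catalogue entry `AxSchanuelFunctionalNotNumerical.lean` (summit
`Schanuel`): the named fact `Literature.Barriers.Schanuel.baysKirbyWilkie2010_thm_1_2` —
M. Bays, J. Kirby, A. J. Wilkie, *A Schanuel property for exponentially transcendental powers*,
Bull. Lond. Math. Soc. 42 (2010) 917–922 (arXiv:0810.4457), Theorem 1.2: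

> Let `F` be any exponential field, let `λ ∈ F` be exponentially transcendental, and let
> `x̄ ∈ Fⁿ` be such that `exp(x̄)` is multiplicatively independent. Then
> `td(exp(x̄), exp(λx̄)/λ) ≥ n`.

— HOLDS: `Literature.Barriers.Schanuel.baysKirbyWilkie2010_thm_1_2_holds`, sorry-free, from the
tree's proof of Ax's theorem (`Literature.NumberTheory.Transcendental.ax_schanuel_holds`) through
Kirby's Theorem 1.2 with dimension term, in the form "`ecl`-closed sets are Γ-closed"
(`Literature.NumberTheory.Transcendental.GammaField.isGammaClosed_span_ecl`, `GammaFieldsEcl.lean`).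

## The printed proof and its rendering

The source proves Thm. 1.2 in three steps (§§2–4):

1. **Prop. 2.1** (a relative Schanuel property for exponentiation): for `C` `ecl`-closed and `p̄`
   `ecl`-independent over `C`, `td(p̄, z̄, exp p̄, exp z̄ / C) - ldim_ℚ(p̄, z̄ / C) ≥ m`, from
   Kirby 2010 Thm. 1.2 (`δ ≥ dim`). Here `m = 1`, `p̄ = λ`, `C = ecl ∅`, and the input is the
   tree's `isGammaClosed_span_ecl` (a proper finitely generated extension of `span (ecl ∅)` has
   predimension `≥ 1`), applied to `C + ℚλ + ℚx̄ + ℚλx̄`.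
2. **Thm. 1.3** via the addition formula for `td` and the inequalities (e1)–(e3): here the
   transcendence degrees are relative ranks in the algebraic matroid of `F/ℚ`
   (`GammaField.td`, `Matroid.relRank` of `Literature/Combinatorics/Matroid/RelRank.lean`), the
   chain being `C ⊆ C ∪ {λ} ⊆ … ∪ {x̄, λx̄} ⊆ … ∪ {e^{x̄}, e^{λx̄}} ⊆ … ∪ {e^λ}`, and the target
   `Algebra.trdeg`-degree is recovered by `GammaField.toENat_trdeg_adjoin_eq_relRank`.
3. **§3–§4, the linear algebra**: linear disjointness of `ℚ(λ)` from `C` over `ℚ` (Lemma 3.2 (iii),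
   here `linearIndependent_adjoin_simple`, elementary for one transcendental element), Lemma 3.3,
   and the filtration `A_{i+1} = A_i ∩ λ⁻¹A_i` of the proof of Thm. 1.2 (here the Key Lemma
   `finrank_span_le_ldim_sup_map`: `dim_K(K·X) ≤ ldim_ℚ(X + λX / X)`, by induction on `dim X`
   through `X' = {v ∈ X | λv ∈ X} ⊊ X`), assembled in `exists_finset_le_ldim`.

Deviation (a simplification, not a weakening): the source routes the count through the kernel
`ker` of `exp` (`ld(·/ker)`, a finite tuple `k̄ ⊆ ker`); since multiplicative independence of
`exp x̄` already makes `x̄` `ℚ`-linearly independent (`linearIndependent_of_isMultIndepExp`), the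
same argument with `k̄ = ∅` suffices, and `ker` does not appear. No new definitions and no new
named facts are introduced.

## References

* [BaysKirbyWilkie2010] M. Bays, J. Kirby, A. J. Wilkie, Bull. Lond. Math. Soc. 42 (2010)
  917–922, arXiv:0810.4457: Thm. 1.2, Prop. 2.1, Lemma 3.2, Lemma 3.3, §4.
* [Kirby2010] J. Kirby, *Exponential algebraicity in exponential fields*, Bull. Lond. Math. Soc.
  42 (2010) 879–890: Thm. 1.2.
* [Ax1971] J. Ax, *On Schanuel's conjectures*, Ann. of Math. 93 (1971) 252–268, Thm. 3.
-/

noncomputable section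

open Cardinal Set

namespace Literature.Barriers.Schanuel

namespace BaysKirbyWilkie

open Literature.NumberTheory.Transcendental Literature.NumberTheory.Transcendental.GammaField

/-! ### 1. Linear-dimension helpers -/

section LinearDimension

variable {k V : Type*} [Field k] [AddCommGroup V] [Module k V]

/-- `ldim(Λ'/0) = dim Λ'`. [folklore] -/
theorem ldim_bot (Λ' : Submodule k V) : ldim (⊥ : Submodule k V) Λ' = Module.finrank k Λ' := by
  rw [ldim]
  have hinj : Function.Injective ((⊥ : Submodule k V).mkQ) := by
    rw [← LinearMap.ker_eq_bot, Submodule.ker_mkQ]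
  exact (Submodule.equivMapOfInjective _ hinj Λ').finrank_eq.symm

/-- For `Y ≤ X`, `dim X = dim Y + ldim(X/Y)` (when `X/Y` is finite-dimensional and `Y` is). [folklore] -/
theorem finrank_eq_finrank_add_ldim {X Y : Submodule k V} (h : Y ≤ X) (hfg : IsFG (⊥ : Submodule k V) X) :
    Module.finrank k X = Module.finrank k Y + ldim Y X := by
  rw [← ldim_bot, ← ldim_bot, ldim_add bot_le h hfg]

/-- A finite-dimensional subspace is finitely generated over `⊥`. [folklore] -/
theorem isFG_bot_of_finiteDimensional (X : Submodule k V) [FiniteDimensional k X] :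
    IsFG (⊥ : Submodule k V) X := by
  rw [isFG_iff_finite]
  exact Module.Finite.map _ _

/-- Lifting a basis of `Λ'/Λ`: a finitely generated extension `Λ ≤ Λ + Λ'` is generated over `Λ`
by `ldim(Λ'/Λ)` elements of `Λ'`. [folklore] -/
theorem exists_finset_card_le_ldim {Λ Λ' : Submodule k V} (hfg : IsFG Λ Λ') :
    ∃ s : Finset V, (↑s : Set V) ⊆ (Λ' : Set V) ∧ s.card ≤ ldim Λ Λ' ∧
      Λ' ≤ Λ ⊔ Submodule.span k (s : Set V) := by
  classical
  haveI := hfg.finite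
  set W : Submodule k (V ⧸ Λ) := Λ'.map Λ.mkQ with hW
  let b := Module.finBasis k W
  have hmem : ∀ i, ∃ y ∈ Λ', Λ.mkQ y = (b i : V ⧸ Λ) := fun i =>
    Submodule.mem_map.1 (b i).2
  choose g hgΛ' hgb using hmem
  refine ⟨Finset.univ.image g, ?_, ?_, ?_⟩
  · intro v hv
    obtain ⟨i, -, rfl⟩ := Finset.mem_image.1 (Finset.mem_coe.1 hv)
    exact hgΛ' i
  · calc (Finset.univ.image g).card ≤ Finset.univ.card := Finset.card_image_le
      _ = Module.finrank k W := by simp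
      _ = ldim Λ Λ' := rfl
  · intro y hy
    have hy' : Λ.mkQ y ∈ W := Submodule.mem_map_of_mem hy
    -- write the class of `y` in the basis `b`
    set c : Fin (Module.finrank k W) → k := fun i => b.repr ⟨Λ.mkQ y, hy'⟩ i with hc
    have hrepr : (⟨Λ.mkQ y, hy'⟩ : W) = ∑ i, c i • b i := (b.sum_repr _).symm
    have hval : Λ.mkQ y = Λ.mkQ (∑ i, c i • g i) := by
      have h1 := congrArg (Subtype.val : W → V ⧸ Λ) hrepr
      simp only [Submodule.coe_sum, Submodule.coe_smul] at h1
      rw [map_sum]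
      refine h1.trans (Finset.sum_congr rfl fun i _ => ?_)
      rw [map_smul, hgb]
    have hdiff : y - ∑ i, c i • g i ∈ Λ := by
      rw [← Submodule.Quotient.eq, ← Submodule.mkQ_apply, ← Submodule.mkQ_apply]
      exact hval
    have hsum : (∑ i, c i • g i) ∈ Submodule.span k (↑(Finset.univ.image g) : Set V) :=
      Submodule.sum_mem _ fun i _ => Submodule.smul_mem _ _
        (Submodule.subset_span (Finset.mem_coe.2 (Finset.mem_image_of_mem g (Finset.mem_univ i))))
    have : y = (y - ∑ i, c i • g i) + ∑ i, c i • g i := by abel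
    rw [this]
    exact Submodule.add_mem_sup hdiff hsum

end LinearDimension

/-! ### 2. The Key Lemma: `dim_ℚ(X + λX) − dim_ℚ X ≥ dim_K (K·X)` -/

section KeyLemma

variable {F : Type*} [Field F] [CharZero F]

/-- Rank–nullity for `v ↦ [λv] : X → (X + λX)/X`: `dim X = ldim(X + λX / X) + dim {v ∈ X | λv ∈ X}`.
[folklore] -/
theorem finrank_eq_ldim_sup_map_add (l : F) (X : Submodule ℚ F) [FiniteDimensional ℚ X] :
    Module.finrank ℚ X = ldim X (X ⊔ X.map (LinearMap.mulLeft ℚ l)) +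
      Module.finrank ℚ ↥(X ⊓ X.comap (LinearMap.mulLeft ℚ l)) := by
  set μ : F →ₗ[ℚ] F := LinearMap.mulLeft ℚ l with hμ
  set φ : X →ₗ[ℚ] F ⧸ X := X.mkQ ∘ₗ (μ ∘ₗ X.subtype) with hφ
  have hrange : LinearMap.range φ = (X.map μ).map X.mkQ := by
    rw [hφ, LinearMap.range_comp, LinearMap.range_comp, Submodule.range_subtype]
  have hker : LinearMap.ker φ = (X ⊓ X.comap μ).comap X.subtype := by
    ext ⟨v, hv⟩
    simp only [hφ, LinearMap.mem_ker, LinearMap.comp_apply, Submodule.subtype_apply,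
      Submodule.mkQ_apply, Submodule.Quotient.mk_eq_zero, Submodule.mem_comap, Submodule.mem_inf]
    exact ⟨fun h => ⟨hv, h⟩, fun h => h.2⟩
  have h1 : Module.finrank ℚ (LinearMap.range φ) = ldim X (X ⊔ X.map μ) := by
    rw [ldim_sup_left, ldim, hrange]
  have h2 : Module.finrank ℚ (LinearMap.ker φ) = Module.finrank ℚ ↥(X ⊓ X.comap μ) := by
    rw [hker]
    exact (Submodule.comapSubtypeEquivOfLe inf_le_left).finrank_eq
  have := LinearMap.finrank_range_add_finrank_ker φ
  rw [h1, h2] at this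
  exact this.symm

/-- The powers `λⁱ v` (`i ∈ ℕ`) of a transcendental `λ` times a non-zero `v` are `ℚ`-linearly
independent. [folklore] -/
theorem linearIndependent_pow_mul {l : F} (hl : Transcendental ℚ l) {v : F} (hv : v ≠ 0) :
    LinearIndependent ℚ (fun i : ℕ => l ^ i * v) := by
  set ψ : Polynomial ℚ →ₗ[ℚ] F :=
    LinearMap.mulRight ℚ v ∘ₗ (Polynomial.aeval l : Polynomial ℚ →ₐ[ℚ] F).toLinearMap with hψ
  have hinj : LinearMap.ker ψ = ⊥ := by
    rw [LinearMap.ker_eq_bot]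
    intro p q hpq
    simp only [hψ, LinearMap.comp_apply, AlgHom.toLinearMap_apply, LinearMap.mulRight_apply] at hpq
    exact transcendental_iff_injective.1 hl (mul_right_cancel₀ hv hpq)
  have h := (Polynomial.basisMonomials ℚ).linearIndependent.map' ψ hinj
  have hfun : ⇑ψ ∘ ⇑(Polynomial.basisMonomials ℚ) = fun i : ℕ => l ^ i * v := by
    funext i
    simp [hψ, Polynomial.coe_basisMonomials]
  rw [hfun] at h
  exact h

/-- If `λ` is transcendental over `ℚ`, no non-zero finite-dimensional `ℚ`-subspace of `F` is
stable under multiplication by `λ`: `{v ∈ X | λv ∈ X} ≠ X`. [folklore] -/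
theorem inf_comap_mulLeft_ne {l : F} (hl : Transcendental ℚ l) {X : Submodule ℚ F}
    [FiniteDimensional ℚ X] (hX : X ≠ ⊥) : X ⊓ X.comap (LinearMap.mulLeft ℚ l) ≠ X := by
  intro heq
  have hstab : X ≤ X.comap (LinearMap.mulLeft ℚ l) := inf_eq_left.1 heq
  obtain ⟨v, hvX, hv0⟩ := Submodule.exists_mem_ne_zero_of_ne_bot hX
  have hpow : ∀ i : ℕ, l ^ i * v ∈ X := by
    intro i
    induction i with
    | zero => simpa using hvX
    | succ i ih =>
      have := hstab ih
      rw [Submodule.mem_comap, LinearMap.mulLeft_apply] at this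
      rw [pow_succ', mul_assoc]
      exact this
  have hli := linearIndependent_pow_mul hl hv0
  let f : ℕ → X := fun i => ⟨l ^ i * v, hpow i⟩
  have hf : LinearIndependent ℚ f := LinearIndependent.of_comp X.subtype hli
  haveI : IsNoetherian ℚ X := inferInstance
  have : Finite ℕ := hf.finite_of_isNoetherian
  exact not_finite ℕ

/-- The `K`-span of a finite-dimensional `ℚ`-subspace is finite-dimensional over `K`. [folklore] -/
theorem finiteDimensional_span_coe (K : IntermediateField ℚ F) (Y : Submodule ℚ F)
    [FiniteDimensional ℚ Y] : FiniteDimensional K (Submodule.span K (Y : Set F)) := by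
  obtain ⟨t, ht⟩ : Y.FG := Module.Finite.iff_fg.1 (inferInstance : Module.Finite ℚ Y)
  rw [← ht, Submodule.span_span_of_tower]
  exact FiniteDimensional.span_finset K t

/-- Generators: for `Y ≤ X`, `dim_K(K·X) ≤ dim_K(K·Y) + ldim(X/Y)`. [folklore] -/
theorem finrank_span_le_finrank_span_add_ldim (K : IntermediateField ℚ F) {X Y : Submodule ℚ F}
    [FiniteDimensional ℚ X] (hYX : Y ≤ X) :
    Module.finrank K (Submodule.span K (X : Set F)) ≤
      Module.finrank K (Submodule.span K (Y : Set F)) + ldim Y X := by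
  classical
  haveI : FiniteDimensional ℚ Y := Submodule.finiteDimensional_of_le hYX
  have hfg : IsFG Y X := (isFG_bot_of_finiteDimensional X).of_le_left bot_le
  obtain ⟨s, -, hcard, hle⟩ := exists_finset_card_le_ldim hfg
  haveI := finiteDimensional_span_coe K Y
  haveI : FiniteDimensional K (Submodule.span K (s : Set F)) := FiniteDimensional.span_finset K s
  have hspan : Submodule.span K (X : Set F) ≤
      Submodule.span K (Y : Set F) ⊔ Submodule.span K (s : Set F) := by
    rw [Submodule.span_le]
    intro x hx
    obtain ⟨y, hy, t, ht, rfl⟩ := Submodule.mem_sup.1 (hle hx)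
    refine Submodule.add_mem_sup (Submodule.subset_span hy) ?_
    exact Submodule.span_le_restrictScalars ℚ K (s : Set F) ht
  calc Module.finrank K (Submodule.span K (X : Set F))
      ≤ Module.finrank K ↥(Submodule.span K (Y : Set F) ⊔ Submodule.span K (s : Set F)) :=
        Submodule.finrank_mono hspan
    _ ≤ Module.finrank K (Submodule.span K (Y : Set F)) +
          Module.finrank K (Submodule.span K (s : Set F)) :=
        Submodule.finrank_add_le_finrank_add_finrank _ _
    _ ≤ Module.finrank K (Submodule.span K (Y : Set F)) + s.card := by
        gcongr; exact finrank_span_finset_le_card s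
    _ ≤ Module.finrank K (Submodule.span K (Y : Set F)) + ldim Y X := by gcongr

/-- **Key Lemma** (the linear algebra of Bays–Kirby–Wilkie's filtration `A_{i+1} = A_i ∩ λ⁻¹A_i`,
proof of Thm. 1.2): for a finite-dimensional `ℚ`-subspace `X` of `F`, a subfield `K ∋ λ` and `λ`
transcendental over `ℚ`, `dim_K(K·X) ≤ ldim_ℚ(X + λX / X)`. Induction on `dim X` through
`X' = {v ∈ X | λv ∈ X} ⊊ X`. [cite: BaysKirbyWilkie2010, §4 (proof of Thm. 1.2)] -/
theorem finrank_span_le_ldim_sup_map (K : IntermediateField ℚ F) {l : F} (hlK : l ∈ K)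
    (hl : Transcendental ℚ l) (X : Submodule ℚ F) [FiniteDimensional ℚ X] :
    Module.finrank K (Submodule.span K (X : Set F)) ≤ ldim X (X ⊔ X.map (LinearMap.mulLeft ℚ l)) := by
  set μ : F →ₗ[ℚ] F := LinearMap.mulLeft ℚ l with hμ
  induction hN : Module.finrank ℚ X using Nat.strong_induction_on generalizing X with
  | _ N ih =>
  by_cases hX : X = ⊥
  · subst hX
    simp
  -- `X' = {v ∈ X | λ v ∈ X}` is a proper subspace
  set X' : Submodule ℚ F := X ⊓ X.comap μ with hX'
  haveI hX'fd : FiniteDimensional ℚ X' := Submodule.finiteDimensional_of_le inf_le_left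
  have hlt : Module.finrank ℚ X' < Module.finrank ℚ X :=
    Submodule.finrank_lt_finrank_of_lt (lt_of_le_of_ne inf_le_left (inf_comap_mulLeft_ne hl hX))
  have hIH := ih (Module.finrank ℚ X') (hN ▸ hlt) X' rfl
  -- `Y = X' + λX' ≤ X`
  set Y : Submodule ℚ F := X' ⊔ X'.map μ with hY
  have hYX : Y ≤ X := by
    refine sup_le inf_le_left ?_
    rw [Submodule.map_le_iff_le_comap]
    exact inf_le_right
  have hX'Y : X' ≤ Y := le_sup_left
  -- dimension bookkeeping
  have hRN : Module.finrank ℚ X = ldim X (X ⊔ X.map μ) + Module.finrank ℚ X' :=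
    finrank_eq_ldim_sup_map_add l X
  have h1 : Module.finrank ℚ X = Module.finrank ℚ X' + ldim X' X :=
    finrank_eq_finrank_add_ldim inf_le_left (isFG_bot_of_finiteDimensional X)
  have h2 : ldim X' X = ldim X' Y + ldim Y X :=
    ldim_add hX'Y hYX ((isFG_bot_of_finiteDimensional X).of_le_left bot_le)
  have hgen := finrank_span_le_finrank_span_add_ldim K hYX
  haveI := finiteDimensional_span_coe K X'
  have hYK : Submodule.span K (Y : Set F) ≤ Submodule.span K (X' : Set F) := by
    rw [Submodule.span_le]
    intro y hy
    obtain ⟨a, ha, b, hb, rfl⟩ := Submodule.mem_sup.1 (show y ∈ Y from hy)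
    refine add_mem (Submodule.subset_span ha) ?_
    obtain ⟨c, hc, rfl⟩ := Submodule.mem_map.1 hb
    rw [hμ, LinearMap.mulLeft_apply]
    have : (l * c : F) = (⟨l, hlK⟩ : K) • c := rfl
    rw [this]
    exact Submodule.smul_mem _ _ (Submodule.subset_span hc)
  have h3 : Module.finrank K (Submodule.span K (Y : Set F)) ≤
      Module.finrank K (Submodule.span K (X' : Set F)) := Submodule.finrank_mono hYK
  -- `hIH : dim_K (K X') ≤ ldim X' Y`, `hRN : dim X = ldim X (X ⊔ μX) + dim X'`
  change Module.finrank K (Submodule.span K (X' : Set F)) ≤ ldim X' Y at hIH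
  omega

end KeyLemma

/-! ### 3. Linear disjointness of `ℚ(λ)` and `C`, and the linear count -/

section LinearCount

variable {F : Type*} [Field F] [CharZero F]

/-- **Linear disjointness of `ℚ(λ)` from `C` over `ℚ`** (Bays–Kirby–Wilkie 2010, Lemma 3.2 (iii)
= Lang, *Algebra*, VIII 3.3, for one element): if `λ` is transcendental over the `ℚ`-subspace
`Λ` (no non-zero polynomial with coefficients in `Λ` vanishes at `λ`), then every `ℚ`-linearly
independent family in `Λ` is `ℚ(λ)`-linearly independent. Proof: clear denominators and compare
coefficients of powers of `λ`. [cite: BaysKirbyWilkie2010, Lemma 3.2 (iii)] -/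
theorem linearIndependent_adjoin_simple {l : F} (Λ : Submodule ℚ F)
    (htr : ∀ p : Polynomial F, (∀ m, p.coeff m ∈ Λ) → p.eval l = 0 → p = 0)
    {ι : Type*} {c : ι → F} (hc : ∀ i, c i ∈ Λ) (hli : LinearIndependent ℚ c) :
    LinearIndependent (IntermediateField.adjoin ℚ ({l} : Set F)) c := by
  classical
  set K : IntermediateField ℚ F := IntermediateField.adjoin ℚ ({l} : Set F) with hK
  rw [linearIndependent_iff']
  intro t g hsum i hi
  -- `g j = r_j(λ) / s_j(λ)` with `s_j(λ) ≠ 0`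
  have hrep : ∀ j, ∃ r s : Polynomial ℚ, Polynomial.aeval l s ≠ 0 ∧
      ((g j : K) : F) = Polynomial.aeval l r / Polynomial.aeval l s := by
    intro j
    obtain ⟨r, s, h⟩ := (IntermediateField.mem_adjoin_simple_iff (F := ℚ) (α := l) ((g j : K) : F)).1 (g j).2
    by_cases hs : Polynomial.aeval l s = 0
    · refine ⟨0, 1, by simp, ?_⟩
      rw [h, hs, div_zero]
      simp
    · exact ⟨r, s, hs, h⟩
  choose r s hs0 hgrs using hrep
  -- clear denominators
  set D : F := ∏ j ∈ t, Polynomial.aeval l (s j) with hD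
  have hD0 : D ≠ 0 := Finset.prod_ne_zero_iff.2 fun j _ => hs0 j
  set P : ι → Polynomial ℚ := fun j => r j * ∏ k ∈ t.erase j, s k with hP
  have hPeval : ∀ j ∈ t, (Polynomial.aeval l (P j) : F) = D * ((g j : K) : F) := by
    intro j hj
    simp only [hP, map_mul, map_prod]
    rw [hgrs j, hD, ← Finset.mul_prod_erase t (fun k => Polynomial.aeval l (s k)) hj]
    have hsj := hs0 j
    field_simp
  -- the polynomial `Q = ∑ P_j(T) c_j ∈ F[T]` has coefficients in `Λ` and vanishes at `λ`
  set Q : Polynomial F := ∑ j ∈ t, (P j).map (algebraMap ℚ F) * Polynomial.C (c j) with hQ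
  have hQcoeff : ∀ m, Q.coeff m = ∑ j ∈ t, ((P j).coeff m) • c j := by
    intro m
    simp only [hQ, Polynomial.finsetSum_coeff, Polynomial.coeff_mul_C, Polynomial.coeff_map,
      Algebra.smul_def]
  have hQmem : ∀ m, Q.coeff m ∈ Λ := fun m => by
    rw [hQcoeff]
    exact Submodule.sum_mem _ fun j _ => Submodule.smul_mem _ _ (hc j)
  have hsmul : ∀ (a : K) (y : F), a • y = (a : F) * y := fun _ _ => rfl
  have hQeval : Q.eval l = 0 := by
    have h1 : Q.eval l = ∑ j ∈ t, Polynomial.aeval l (P j) * c j := by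
      simp only [hQ, Polynomial.eval_finsetSum, Polynomial.eval_mul, Polynomial.eval_C,
        Polynomial.eval_map, Polynomial.aeval_def]
    have h2 : ∑ j ∈ t, Polynomial.aeval l (P j) * c j = D * ∑ j ∈ t, ((g j : K) : F) * c j := by
      rw [Finset.mul_sum]
      refine Finset.sum_congr rfl fun j hj => ?_
      rw [hPeval j hj, mul_assoc]
    have h3 : ∑ j ∈ t, ((g j : K) : F) * c j = 0 := by
      have : ∑ j ∈ t, g j • c j = ∑ j ∈ t, ((g j : K) : F) * c j :=
        Finset.sum_congr rfl fun j _ => hsmul _ _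
      rw [← this, hsum]
    rw [h1, h2, h3, mul_zero]
  have hQ0 : Q = 0 := htr Q hQmem hQeval
  -- compare coefficients: all `P_j = 0` on `t`
  have hPzero : ∀ j ∈ t, P j = 0 := by
    intro j hj
    ext m
    have hm : ∑ k ∈ t, ((P k).coeff m) • c k = 0 := by
      rw [← hQcoeff, hQ0, Polynomial.coeff_zero]
    have := (linearIndependent_iff'.1 hli) t (fun k => (P k).coeff m) hm j hj
    simpa using this
  have hgi : D * ((g i : K) : F) = 0 := by
    rw [← hPeval i hi, hPzero i hi, map_zero]
  have hgi' : ((g i : K) : F) = 0 := (mul_eq_zero.1 hgi).resolve_left hD0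
  exact_mod_cast hgi'

/-- **The linear count** behind Thm. 1.2 (Bays–Kirby–Wilkie 2010, §4, inequalities (e7)–(e9) with
`k̄ = ∅` and `C` in place of `ker`, combined with Lemma 3.3): for `x̄` `ℚ`-linearly independent,
a subfield `K ∋ λ` linearly disjoint from the `ℚ`-subspace `Λ` with `λ` transcendental over `ℚ`,
there are `d` elements `S` with `x̄ ⊆ K·(Λ ∪ S)` and `ldim_ℚ(x̄, λx̄ / Λ) ≥ n + d`.
[cite: BaysKirbyWilkie2010, §4 (proof of Thm. 1.2)] -/
theorem exists_finset_le_ldim (K : IntermediateField ℚ F) {l : F} (hlK : l ∈ K)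
    (hl : Transcendental ℚ l) (Λ : Submodule ℚ F)
    (hLD : ∀ {m : ℕ} {c : Fin m → F}, (∀ i, c i ∈ Λ) → LinearIndependent ℚ c →
      LinearIndependent K c)
    {n : ℕ} {x : Fin n → F} (hx : LinearIndependent ℚ x) :
    ∃ S : Finset F, (∀ i, x i ∈ Submodule.span K ((Λ : Set F) ∪ ↑S)) ∧
      n + S.card ≤ ldim Λ (Submodule.span ℚ (Set.range x ∪ Set.range (fun i => l * x i))) := by
  classical
  set μ : F →ₗ[ℚ] F := LinearMap.mulLeft ℚ l with hμ
  set X : Submodule ℚ F := Submodule.span ℚ (Set.range x) with hXdef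
  haveI hXfd : FiniteDimensional ℚ X := FiniteDimensional.span_of_finite ℚ (Set.finite_range x)
  have hXn : Module.finrank ℚ X = n := by
    rw [hXdef, finrank_span_eq_card hx, Fintype.card_fin]
  set Z : Submodule ℚ F := Submodule.span ℚ (Set.range x ∪ Set.range (fun i => l * x i)) with hZdef
  have hZeq : Z = X ⊔ X.map μ := by
    rw [hZdef, hXdef, Submodule.span_union, Submodule.map_span, ← Set.range_comp]
    rfl
  haveI hZfd : FiniteDimensional ℚ Z := FiniteDimensional.span_of_finite ℚ
    ((Set.finite_range x).union (Set.finite_range _))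
  have hXZ : X ≤ Z := by rw [hZeq]; exact le_sup_left
  -- the `K`-spans
  set KX : Submodule K F := Submodule.span K (X : Set F) with hKX
  set KΛ : Submodule K F := Submodule.span K (Λ : Set F) with hKΛ
  haveI hKXfd : FiniteDimensional K KX := finiteDimensional_span_coe K X
  have hxKX : ∀ i, x i ∈ KX := fun i =>
    Submodule.subset_span (Submodule.subset_span (Set.mem_range_self i))
  have hfgK : IsFG KΛ KX := (isFG_bot_of_finiteDimensional KX).of_le_left bot_le
  obtain ⟨S, hSKX, hScard, hSle⟩ := exists_finset_card_le_ldim hfgK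
  refine ⟨S, fun i => ?_, ?_⟩
  · have := hSle (hxKX i)
    rwa [hKΛ, ← Submodule.span_union] at this
  -- the count: `n + ldim KΛ KX ≤ ldim Λ Z`
  have hkey : Module.finrank K KX ≤ ldim X Z := by
    rw [hZeq]; exact finrank_span_le_ldim_sup_map K hlK hl X
  have hZ1 : Module.finrank ℚ Z = Module.finrank ℚ X + ldim X Z :=
    finrank_eq_finrank_add_ldim hXZ (isFG_bot_of_finiteDimensional Z)
  set Z₀ : Submodule ℚ F := Z ⊓ Λ with hZ₀
  haveI hZ₀fd : FiniteDimensional ℚ Z₀ := Submodule.finiteDimensional_of_le inf_le_left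
  have hZ2 : Module.finrank ℚ Z = Module.finrank ℚ Z₀ + ldim Z₀ Z :=
    finrank_eq_finrank_add_ldim inf_le_left (isFG_bot_of_finiteDimensional Z)
  have hZ3 : ldim Λ Z = ldim Z₀ Z := ldim_eq_ldim_inf Z Λ
  -- linear disjointness: `dim_K (K Z₀) = dim_ℚ Z₀`
  set r := Module.finrank ℚ Z₀ with hr
  set KZ₀ : Submodule K F := Submodule.span K (Z₀ : Set F) with hKZ₀
  have hKZ₀r : Module.finrank K KZ₀ = r := by
    let b := Module.finBasis ℚ Z₀
    set c : Fin r → F := fun i => (b i : F) with hcdef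
    have hcmem : ∀ i, c i ∈ Λ := fun i => (inf_le_right : Z₀ ≤ Λ) (b i).2
    have hcli : LinearIndependent ℚ c := b.linearIndependent.map' Z₀.subtype (Submodule.ker_subtype _)
    have hcK : LinearIndependent K c := hLD hcmem hcli
    have hspan : Submodule.span K (Set.range c) = KZ₀ := by
      refine le_antisymm (Submodule.span_mono ?_) ?_
      · rintro _ ⟨i, rfl⟩; exact (b i).2
      · rw [hKZ₀, Submodule.span_le]
        intro z hz
        have hz' : (⟨z, hz⟩ : Z₀) ∈ Submodule.span ℚ (Set.range b) := b.mem_span _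
        have hz'' : z ∈ Submodule.span ℚ (Set.range c) := by
          have := Submodule.mem_map_of_mem (f := Z₀.subtype) hz'
          rw [Submodule.map_span, ← Set.range_comp] at this
          exact this
        exact Submodule.span_le_restrictScalars ℚ K (Set.range c) hz''
    rw [← hspan, finrank_span_eq_card hcK, Fintype.card_fin]
  -- `K Z₀ ≤ K X ⊓ K Λ`
  have hKZle : Submodule.span K (Z : Set F) ≤ KX := by
    rw [hZdef, Submodule.span_span_of_tower, Submodule.span_le]
    rintro _ (⟨i, rfl⟩ | ⟨i, rfl⟩)
    · exact hxKX i
    · show l * x i ∈ KX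
      have : (l * x i : F) = (⟨l, hlK⟩ : K) • x i := rfl
      rw [this]
      exact Submodule.smul_mem _ _ (hxKX i)
  have hKZ₀le : KZ₀ ≤ KX ⊓ KΛ :=
    le_inf ((Submodule.span_mono (show (Z₀ : Set F) ⊆ (Z : Set F) from
      fun _ hz => (inf_le_left : Z₀ ≤ Z) hz)).trans hKZle)
      (Submodule.span_mono (show (Z₀ : Set F) ⊆ (Λ : Set F) from
        fun _ hz => (inf_le_right : Z₀ ≤ Λ) hz))
  have hK1 : Module.finrank K KX = Module.finrank K KZ₀ + ldim KZ₀ KX :=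
    finrank_eq_finrank_add_ldim (hKZ₀le.trans inf_le_left) (isFG_bot_of_finiteDimensional KX)
  have hK2 : ldim KZ₀ KX = ldim KZ₀ (KX ⊓ KΛ) + ldim (KX ⊓ KΛ) KX :=
    ldim_add hKZ₀le inf_le_left ((isFG_bot_of_finiteDimensional KX).of_le_left bot_le)
  have hK3 : ldim KΛ KX = ldim (KX ⊓ KΛ) KX := ldim_eq_ldim_inf KX KΛ
  omega

end LinearCount

/-! ### 4. `x̄` is `ℚ`-linearly independent when `exp x̄` is multiplicatively independent -/

section MultIndep

variable {F : Type*} [Field F] [CharZero F] [Literature.ModelTheory.ExponentialFields.ExponentialRing F]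

/-- If `exp x₁, …, exp xₙ` are multiplicatively independent then `x₁, …, xₙ` are `ℚ`-linearly
independent (a rational relation, cleared of denominators, exponentiates to a multiplicative
one). [cite: BaysKirbyWilkie2010, §1] -/
theorem linearIndependent_of_isMultIndepExp {n : ℕ} {x : Fin n → F} (hx : IsMultIndepExp x) :
    LinearIndependent ℚ x := by
  classical
  rw [Fintype.linearIndependent_iff]
  intro g hg i
  obtain ⟨d, hd, w, hw⟩ := exists_nat_mul_eq_intCast g
  have hsum : ∑ j, (w j : F) * x j = 0 := by
    have h1 : ∑ j, (w j : F) * x j = (d : F) * ∑ j, g j • x j := by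
      rw [Finset.mul_sum]
      refine Finset.sum_congr rfl fun j _ => ?_
      rw [Rat.smul_def, ← mul_assoc]
      congr 1
      have h2 : (((d : ℚ) : F)) * ((g j : ℚ) : F) = ((w j : ℤ) : F) := by
        rw [← Rat.cast_mul, hw j, Rat.cast_intCast]
      rw [← h2, Rat.cast_natCast]
    rw [h1, hg, mul_zero]
  have hprod : (∏ j, Literature.ModelTheory.ExponentialFields.ExponentialRing.exp (x j) ^ (w j)) = 1 := by
    rw [← exp_sum_intCast_mul, hsum, Literature.ModelTheory.ExponentialFields.ExponentialRing.exp_zero]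
  have hw0 : w = 0 := hx w hprod
  have : (d : ℚ) * g i = 0 := by rw [hw i, hw0, Pi.zero_apply, Int.cast_zero]
  exact (mul_eq_zero.1 this).resolve_left (Nat.cast_ne_zero.2 hd)

end MultIndep

end BaysKirbyWilkie

/-! ### 5. The theorem -/

open Literature.NumberTheory.Transcendental Literature.NumberTheory.Transcendental.GammaField
open Literature.ModelTheory.ExponentialFields.ExponentialRing
open BaysKirbyWilkie

/-- **Bays–Kirby–Wilkie 2010, Theorem 1.2, HOLDS** (discharge of the named fact
`baysKirbyWilkie2010_thm_1_2`): in any exponential field `F` (characteristic `0`), if `λ ∉ ecl ∅`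
and `exp x̄` is multiplicatively independent then `td(exp x̄, exp λx̄ / λ) ≥ n`.

Proof (the printed one, §§2–4 of the source, with `m = 1`, `C = ecl ∅`, and `k̄ = ∅` — the
kernel of `exp` is not needed since multiplicative independence of `exp x̄` makes `x̄`
`ℚ`-linearly independent): (1) Kirby's Thm. 1.2 with dimension term `≥ 1` in the form "`ecl ∅` is
Γ-closed" (`GammaField.isGammaClosed_span_ecl`, from Ax's theorem `ax_schanuel_holds`) applied to
`C + ℚλ + ℚx̄ + ℚλx̄` gives `td(λ, x̄, λx̄, e^λ, e^{x̄}, e^{λx̄} / C) ≥ ldim_ℚ(x̄, λx̄ / C) + ε + 1`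
(`ε = [λ ∉ C + ℚx̄ + ℚλx̄]`; Prop. 2.1); (2) the addition formula in the algebraic matroid bounds
the left side by `1 + d + td(e^{x̄}, e^{λx̄} / λ) + ε` whenever `x̄ ⊆ ℚ(λ)·(C ∪ S)`, `|S| = d`
(inequalities (e1)–(e3)); (3) the linear count `ldim_ℚ(x̄, λx̄ / C) ≥ n + d`
(`exists_finset_le_ldim`: linear disjointness of `ℚ(λ)` and `C`, Lemma 3.2–3.3, and the
filtration argument of §4, `finrank_span_le_ldim_sup_map`).
[cite: BaysKirbyWilkie2010, Thm. 1.2] -/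
theorem baysKirbyWilkie2010_thm_1_2_holds : baysKirbyWilkie2010_thm_1_2 := by
  intro F _ _ _ l hl n x hx
  classical
  set K : IntermediateField ℚ F := IntermediateField.adjoin ℚ ({l} : Set F) with hK
  set E : Set F := Set.range (exp ∘ x) ∪ Set.range (exp ∘ fun i => l * x i) with hE
  set M : Matroid F := algMatroid F with hM
  -- Step A: the target transcendence degree is the relative rank of `E` over `{λ}`
  suffices h : (n : ℕ∞) ≤ M.relRank ({l} : Set F) E by
    have h1 : M.relRank ({l} : Set F) E = M.relRank (K : Set F) E :=
      M.relRank_congr_closure_left E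
        (show M.closure {l} = M.closure (K : Set F) from (acl_adjoin ({l} : Set F)).symm)
    rw [h1, ← toENat_trdeg_adjoin_eq_relRank K E] at h
    exact Cardinal.natCast_le_toENat.1 h
  -- the base `C = ecl ∅` as a `ℚ`-subspace `Λ`
  set C : Set F := ecl (∅ : Set F) with hC
  set Λ : Submodule ℚ F := Submodule.span ℚ C with hΛ
  have hmemΛ : ∀ {a : F}, a ∈ Λ ↔ a ∈ C := fun {a} => mem_span_ecl_iff
  have hΓ : IsGammaClosed Λ := isGammaClosed_span_ecl ax_schanuel_holds ∅
  have hlC : l ∉ C := hl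
  have hlΛ : l ∉ Λ := fun h => hlC (hmemΛ.1 h)
  have hltr : Transcendental ℚ l := fun halg => hlC (mem_ecl_of_isAlgebraic ∅ halg)
  have htrΛ : ∀ p : Polynomial F, (∀ m, p.coeff m ∈ Λ) → p.eval l = 0 → p = 0 := by
    intro p hp hpl
    by_contra hp0
    exact hlC (Khovanskii.mem_ecl_of_isRoot hp0 (fun m => hmemΛ.1 (hp m)) hpl)
  have hLD : ∀ {m : ℕ} {c : Fin m → F}, (∀ i, c i ∈ Λ) → LinearIndependent ℚ c →
      LinearIndependent K c := fun hc hli => linearIndependent_adjoin_simple Λ htrΛ hc hli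
  have hlK : l ∈ K := IntermediateField.mem_adjoin_simple_self ℚ l
  have hxli : LinearIndependent ℚ x := linearIndependent_of_isMultIndepExp hx
  -- Step LA: the linear count
  obtain ⟨S, hxS, hcount⟩ := exists_finset_le_ldim K hlK hltr Λ hLD hxli
  set W : Set F := Set.range x ∪ Set.range (fun i => l * x i) with hW
  set Z : Submodule ℚ F := Submodule.span ℚ W with hZ
  have hWfin : W.Finite := (Set.finite_range x).union (Set.finite_range _)
  have hEW : exp '' W = E := by
    rw [hW, hE, Set.image_union, ← Set.range_comp, ← Set.range_comp]
  -- Step D: Γ-closedness of `C` at `C + ℚλ + ℚ x̄ + ℚ λx̄`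
  set S₁ : Set F := insert l W with hS₁
  have hS₁fin : S₁.Finite := hWfin.insert l
  set ε : ℕ := ldim (Λ ⊔ Z) (Submodule.span ℚ {l}) with hε
  have hldim : ldim Λ (Submodule.span ℚ S₁) = ldim Λ Z + ε := by
    have hfg : IsFG Λ (Λ ⊔ Z ⊔ Submodule.span ℚ {l}) := by
      rw [sup_assoc]
      exact isFG_sup_left.2 ((isFG_span_of_finite Λ hWfin).sup
        (isFG_span_of_finite Λ (Set.finite_singleton l)))
    have h1 := ldim_add (le_sup_left : Λ ≤ Λ ⊔ Z) (le_sup_left : Λ ⊔ Z ≤ Λ ⊔ Z ⊔ Submodule.span ℚ {l}) hfg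
    rw [ldim_sup_left (Λ ⊔ Z) (Submodule.span ℚ {l}), ldim_sup_left Λ Z, sup_assoc,
      ldim_sup_left Λ (Z ⊔ Submodule.span ℚ {l})] at h1
    have h2 : Submodule.span ℚ S₁ = Z ⊔ Submodule.span ℚ {l} := by
      rw [hS₁, Submodule.span_insert, sup_comm]
    rw [h2, h1]
  have hpredim : ldim Λ Z + ε + 1 ≤ (td Λ (Submodule.span ℚ S₁)).toNat := by
    have hfg : IsFG Λ (Λ ⊔ Submodule.span ℚ S₁) := isFG_sup_left.2 (isFG_span_of_finite Λ hS₁fin)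
    have hne : Λ ⊔ Submodule.span ℚ S₁ ≠ Λ := by
      intro heq
      apply hlΛ
      rw [← heq]
      exact Submodule.mem_sup_right (Submodule.subset_span (Set.mem_insert l W))
    have h1 := hΓ.one_le_predim le_sup_left hfg hne
    rw [predim_sup_left, predim_def, hldim] at h1
    omega
  have htdle : td Λ (Submodule.span ℚ S₁) ≤ M.relRank C (S₁ ∪ exp '' S₁) := by
    have := td_span_le_relRank Λ S₁
    rwa [gens_span_ecl] at this
  -- Step E: the chain `C ⊆ C ∪ {λ} ⊆ … ∪ W ⊆ … ∪ E ⊆ … ∪ {e^λ}` in the algebraic matroid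
  set B₁ : Set F := insert l C with hB₁
  set B₂ : Set F := B₁ ∪ W with hB₂
  set B₃ : Set F := B₂ ∪ E with hB₃
  set B₄ : Set F := insert (exp l) B₃ with hB₄
  have hCB₁ : C ⊆ B₁ := Set.subset_insert l C
  have hB₁₂ : B₁ ⊆ B₂ := Set.subset_union_left
  have hB₂₃ : B₂ ⊆ B₃ := Set.subset_union_left
  have hB₃₄ : B₃ ⊆ B₄ := Set.subset_insert _ _
  have hsub : S₁ ∪ exp '' S₁ ⊆ B₄ := by
    rw [hS₁, Set.image_insert_eq, hEW]
    refine Set.union_subset ?_ ?_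
    · refine Set.insert_subset (hB₃₄ (hB₂₃ (hB₁₂ (Set.mem_insert l C)))) ?_
      exact Set.subset_union_right.trans (hB₂₃.trans hB₃₄)
    · exact Set.insert_subset_insert Set.subset_union_right
  -- (a) `λ` costs at most one
  have ha : M.relRank C B₁ ≤ 1 := by
    have := M.relRank_insert_le C C l
    rwa [M.relRank_self, zero_add] at this
  -- (b) `x̄, λx̄` cost at most `|S|` over `C ∪ {λ}`
  have hb : M.relRank B₁ B₂ ≤ S.card := by
    have hWcl : W ⊆ M.closure (↑S ∪ B₁) := by
      have hspan : (Submodule.span K ((Λ : Set F) ∪ ↑S) : Set F) ⊆ acl (↑S ∪ B₁) := by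
        intro a ha
        induction ha using Submodule.span_induction with
        | mem u hu =>
          rcases hu with hu | hu
          · exact subset_acl _ (Or.inr (hCB₁ (hmemΛ.1 hu)))
          · exact subset_acl _ (Or.inl hu)
        | zero => exact zero_mem_acl _
        | add u v _ _ hu hv => exact add_mem_acl hu hv
        | smul k u _ hu =>
          have hk : ((k : K) : F) ∈ acl (↑S ∪ B₁) := by
            have h1 : ((k : K) : F) ∈ acl ({l} : Set F) := adjoin_subset_acl ({l} : Set F) k.2
            have h2 : ({l} : Set F) ⊆ ↑S ∪ B₁ :=
              Set.singleton_subset_iff.2 (Or.inr (Set.mem_insert l C))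
            exact acl_mono h2 h1
          exact mul_mem_acl hk hu
      rintro a (⟨i, rfl⟩ | ⟨i, rfl⟩)
      · exact hspan (hxS i)
      · have : (l * x i : F) = (⟨l, hlK⟩ : K) • x i := rfl
        refine hspan ?_
        show l * x i ∈ (Submodule.span K ((Λ : Set F) ∪ ↑S) : Set F)
        rw [SetLike.mem_coe, this]
        exact Submodule.smul_mem _ _ (hxS i)
    calc M.relRank B₁ B₂ = M.relRank B₁ W := M.relRank_union_self_left B₁ W
      _ ≤ M.relRank B₁ ↑S := M.relRank_le_of_subset_closure B₁ hWcl
      _ ≤ (↑S \ B₁).encard := M.relRank_le_encard_diff B₁ ↑S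
      _ ≤ (↑S : Set F).encard := Set.encard_le_encard fun _ h => h.1
      _ = S.card := Set.encard_coe_eq_coe_finsetCard S
  -- (c) `exp x̄, exp λx̄` cost at most `td(exp x̄, exp λx̄ / λ)`
  have hc : M.relRank B₂ B₃ ≤ M.relRank ({l} : Set F) E := by
    rw [hB₃, M.relRank_union_self_left]
    exact M.relRank_anti_left E (Set.singleton_subset_iff.2 (hB₁₂ (Set.mem_insert l C)))
  -- (d) `exp λ` costs at most `ε`
  have hd : M.relRank B₃ B₄ ≤ ε := by
    by_cases hlZ : l ∈ Λ ⊔ Z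
    · have hmem : exp l ∈ M.closure (B₃ ∪ B₃) := by
        rw [Set.union_self]
        have h1 : exp l ∈ gens (Λ ⊔ Submodule.span ℚ W) := exp_mem_gens hlZ
        have h2 := gens_sup_span_subset_acl Λ W h1
        rw [gens_span_ecl, hEW] at h2
        refine acl_mono ?_ h2
        refine Set.union_subset ((hCB₁.trans hB₁₂).trans hB₂₃) (Set.union_subset ?_ ?_)
        · exact (Set.subset_union_right.trans hB₂₃)
        · exact Set.subset_union_right
      rw [hB₄, M.relRank_insert_eq_of_mem_closure hmem, M.relRank_self]
      simp
    · have hε1 : ε = 1 := ldim_span_singleton_of_not_mem hlZ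
      rw [hε1]
      have := M.relRank_insert_le B₃ B₃ (exp l)
      rwa [M.relRank_self, zero_add] at this
  -- assembling the chain
  have hchain : M.relRank C B₄ ≤ 1 + S.card + M.relRank ({l} : Set F) E + ε := by
    rw [← M.relRank_add_relRank ((hCB₁.trans hB₁₂).trans hB₂₃) hB₃₄,
      ← M.relRank_add_relRank (hCB₁.trans hB₁₂) hB₂₃, ← M.relRank_add_relRank hCB₁ hB₁₂]
    gcongr
  have htot : ((ldim Λ Z + ε + 1 : ℕ) : ℕ∞) ≤ 1 + S.card + M.relRank ({l} : Set F) E + ε := by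
    have hfin : td Λ (Submodule.span ℚ S₁) ≠ ⊤ := td_ne_top (isFG_span_of_finite Λ hS₁fin)
    calc ((ldim Λ Z + ε + 1 : ℕ) : ℕ∞) ≤ ((td Λ (Submodule.span ℚ S₁)).toNat : ℕ∞) := by
          exact_mod_cast hpredim
      _ = td Λ (Submodule.span ℚ S₁) := ENat.coe_toNat hfin
      _ ≤ M.relRank C (S₁ ∪ exp '' S₁) := htdle
      _ ≤ M.relRank C B₄ := M.relRank_mono_right C hsub
      _ ≤ _ := hchain
  -- arithmetic
  rcases eq_or_ne (M.relRank ({l} : Set F) E) ⊤ with htop | hnt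
  · rw [htop]; exact le_top
  obtain ⟨t, ht⟩ := ENat.ne_top_iff_exists.1 hnt
  rw [← ht] at htot ⊢
  have h' : ldim Λ Z + ε + 1 ≤ 1 + S.card + t + ε := by
    have : ((ldim Λ Z + ε + 1 : ℕ) : ℕ∞) ≤ ((1 + S.card + t + ε : ℕ) : ℕ∞) := by
      push_cast; exact htot
    exact_mod_cast this
  exact_mod_cast (show n ≤ t by omega)


end Literature.Barriers.Schanuel

end
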